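import Summits.QuantumFields.YangMills.Theorems.QuantileBitPurityFluxNumerics
import HarnessLib

/-!
# Numeric inequalities for the periodic-sector core estimate (route `FluxSectorLaplace`, crux K2)

Support module (`--supports` stmt-QuantumFields-24080, `FluxSectorLaplace.PeriodicCoreRaritySubQuartic`; seat ym-dw-p1 g17).  Pure real-variable
bookkeeping, no lattice object.  Parameters: window `L ≤ β^a` (`0 < a ≤ 1/400`), core radius `r = β^(−2/5)`, seam-axis shift angle `θ = β^(−13/40)`,
axis thresholds `χ = β^(−1/4)`, closeness scale `η = β^(−(1/2 − 1/40))`, `K = ⌈64eβ^a⌉₊` own-axis translates of step `6r`, annulus inner radius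
`c₀ = (4/3)θ − 2r`, floor `σ = c₀/4`.  We prove the cost inequality of the seam-axis shift on a ring of `≤ 2L` slices (`gaxis_core_Q`), the
shift/Jacobian/cost inequalities of the own-axis translates from one master bound in RATIO form (`shift_jac_cost_of_ratio`, any floor `σ`), the floor and
master inequalities of the annulus, the final rate `(e + 1/2)β^(−a) ≤ β^(−a/2)`, and package everything as ★ `numericsCore_of_le`.

HONEST FRAMING: elementary real analysis; nothing about lattice gauge theory.  No `sorry`, no new axiom, no new definition.  References: [folklore].
-/

set_option autoImplicit false

noncomputable section

open Real

namespace Summit.QuantumFields.YangMills.Theorems.FemtoTransferGap.OwnAxis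

section Core

variable {a β : ℝ} {L : ℕ}

/-- ★ (shift, Jacobian, cost from ONE master bound, ratio form, any floor): if `R = Kθ'/σ ≥ 0`, `βη² ≥ 1`, `L ≥ 1` and `1000 L⁶ R (βη²) ≤ 1` then
`R ≤ 1/2`, `4L⁴R ≤ 1/2` and `12βL⁴((R·2Lη)² + 2(R·2Lη)η) ≤ 1`. [folklore] -/
theorem shift_jac_cost_of_ratio {R η : ℝ} (hR0 : 0 ≤ R) (hβη : 1 ≤ β * η ^ 2) (hL1 : (1 : ℝ) ≤ L)
    (hM : 1000 * (L : ℝ) ^ 6 * R * (β * η ^ 2) ≤ 1) :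
    R ≤ 1 / 2 ∧ 4 * (L : ℝ) ^ 4 * R ≤ 1 / 2 ∧
      12 * β * (L : ℝ) ^ 4 * ((R * (2 * (L * η))) ^ 2 + 2 * (R * (2 * (L * η))) * η) ≤ 1 := by
  have hL6 : (1 : ℝ) ≤ (L : ℝ) ^ 6 := one_le_pow₀ hL1
  have hL4 : (1 : ℝ) ≤ (L : ℝ) ^ 4 := one_le_pow₀ hL1
  have hRL : (L : ℝ) ^ 6 * R ≤ 1 / 1000 := by nlinarith
  have hR1 : R ≤ 1 / 1000 := by nlinarith
  refine ⟨by linarith, ?_, ?_⟩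
  · have : (L : ℝ) ^ 4 * R ≤ 1 / 1000 := by nlinarith [pow_le_pow_right₀ hL1 (show 4 ≤ 6 by norm_num)]
    nlinarith
  · have e : 12 * β * (L : ℝ) ^ 4 * ((R * (2 * (L * η))) ^ 2 + 2 * (R * (2 * (L * η))) * η) =
        48 * ((L : ℝ) ^ 6 * R * (β * η ^ 2)) * R + 48 * ((L : ℝ) ^ 5 * R * (β * η ^ 2)) := by ring
    rw [e]
    have h5 : (L : ℝ) ^ 5 * R * (β * η ^ 2) ≤ (L : ℝ) ^ 6 * R * (β * η ^ 2) := by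
      have : (L : ℝ) ^ 5 ≤ (L : ℝ) ^ 6 := pow_le_pow_right₀ hL1 (by norm_num)
      have hb : 0 ≤ R * (β * η ^ 2) := by positivity
      nlinarith
    nlinarith

/-- `θη/χ = β^{−11/20}`. [folklore] -/
theorem theta_eta_div_chi (hβ0 : 0 < β) :
    β ^ (-(13 / 40 : ℝ)) * β ^ (-(1 / 2 - 1 / 40 : ℝ)) / β ^ (-(1 / 4 : ℝ)) = β ^ (-(11 / 20 : ℝ)) := by
  rw [← Real.rpow_add hβ0, ← Real.rpow_sub hβ0]; norm_num

/-- `θχ ≤ β^{−11/20}`. [folklore] -/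
theorem theta_chi_le (hβ1 : 1 ≤ β) : β ^ (-(13 / 40 : ℝ)) * β ^ (-(1 / 4 : ℝ)) ≤ β ^ (-(11 / 20 : ℝ)) := by
  rw [← Real.rpow_add (by linarith)]
  exact Real.rpow_le_rpow_of_exponent_le hβ1 (by norm_num)

/-- `θη ≤ β^{−11/20}`. [folklore] -/
theorem theta_eta_le (hβ1 : 1 ≤ β) : β ^ (-(13 / 40 : ℝ)) * β ^ (-(1 / 2 - 1 / 40 : ℝ)) ≤ β ^ (-(11 / 20 : ℝ)) := by
  rw [← Real.rpow_add (by linarith)]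
  exact Real.rpow_le_rpow_of_exponent_le hβ1 (by norm_num)

/-- `β X² = L⁴ β^{−1/10}` and `β X η = L² β^{−1/40}` for `X = L² β^{−11/20}`. [folklore] -/
theorem beta_X_sq (hβ0 : 0 < β) : β * ((L : ℝ) ^ 2 * β ^ (-(11 / 20 : ℝ))) ^ 2 = (L : ℝ) ^ 4 * β ^ (-(1 / 10 : ℝ)) := by
  have h : β * (β ^ (-(11 / 20 : ℝ))) ^ 2 = β ^ (-(1 / 10 : ℝ)) := by
    rw [← Real.rpow_natCast (β ^ (-(11 / 20 : ℝ))) 2, ← Real.rpow_mul hβ0.le]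
    nth_rw 1 [← Real.rpow_one β]
    rw [← Real.rpow_add hβ0]; norm_num
  calc β * ((L : ℝ) ^ 2 * β ^ (-(11 / 20 : ℝ))) ^ 2 = (L : ℝ) ^ 4 * (β * (β ^ (-(11 / 20 : ℝ))) ^ 2) := by ring
    _ = (L : ℝ) ^ 4 * β ^ (-(1 / 10 : ℝ)) := by rw [h]

/-- `β X η = L² β^{−1/40}`. [folklore] -/
theorem beta_X_eta (hβ0 : 0 < β) :
    β * ((L : ℝ) ^ 2 * β ^ (-(11 / 20 : ℝ))) * β ^ (-(1 / 2 - 1 / 40 : ℝ)) = (L : ℝ) ^ 2 * β ^ (-(1 / 40 : ℝ)) := by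
  have h : β * β ^ (-(11 / 20 : ℝ)) * β ^ (-(1 / 2 - 1 / 40 : ℝ)) = β ^ (-(1 / 40 : ℝ)) := by
    nth_rw 1 [← Real.rpow_one β]
    rw [← Real.rpow_add hβ0, ← Real.rpow_add hβ0]; norm_num
  calc β * ((L : ℝ) ^ 2 * β ^ (-(11 / 20 : ℝ))) * β ^ (-(1 / 2 - 1 / 40 : ℝ)) = (L : ℝ) ^ 2 * (β * β ^ (-(11 / 20 : ℝ)) * β ^ (-(1 / 2 - 1 / 40 : ℝ))) := by
        ring
    _ = (L : ℝ) ^ 2 * β ^ (-(1 / 40 : ℝ)) := by rw [h]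

/-- ★ (cost of the seam-axis shift on a ring of `≤ 2L` slices) with `θ = β^{−13/40}`, `χ = β^{−1/4}`, `η = β^{−(1/2−1/40)}`:
`β·2L·3L³(D_s² + 2D_sη) + 3L³(D_g² + 2D_gη) ≤ 1` on `L ≤ β^a` for `β ≥ 1578^{1/(1/40 − 8a)}`, `a < 1/320`. [folklore] -/
theorem gaxis_core_Q {θ χ η Ds Dg : ℝ} (hθ : θ = β ^ (-(13 / 40 : ℝ))) (hχ : χ = β ^ (-(1 / 4 : ℝ))) (hη : η = β ^ (-(1 / 2 - 1 / 40 : ℝ)))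
    (hDs : Ds = θ * (2 * (L * (L * η)) / χ + L * (L * η) / χ + 2 * χ) + 2 * (L * (L * η)) * θ + 2 * ((2 * L) * η) * θ)
    (hDg : Dg = 2 * χ * θ + 4 * (L * ((2 * L) * η)) * θ)
    (ha : 0 < a) (ha' : a ≤ 1 / 400) (hβ1 : 1 ≤ β) (hL1 : (1 : ℝ) ≤ L) (hL : (L : ℝ) ≤ β ^ a)
    (hβ : (1578 : ℝ) ^ (1 / (-(8 * a - 1 / 40))) ≤ β) :
    β * (2 * (L : ℝ)) * (3 * (L : ℝ) ^ 3 * (Ds ^ 2 + 2 * Ds * η)) + 3 * (L : ℝ) ^ 3 * (Dg ^ 2 + 2 * Dg * η) ≤ 1 := by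
  have hβ0 : 0 < β := by linarith
  have ha320 : 8 * a - 1 / 40 < 0 := by linarith
  set Y : ℝ := β ^ (-(11 / 20 : ℝ)) with hY
  set X : ℝ := (L : ℝ) ^ 2 * Y with hX
  have hθ0 : 0 < θ := by rw [hθ]; exact Real.rpow_pos_of_pos hβ0 _
  have hχ0 : 0 < χ := by rw [hχ]; exact Real.rpow_pos_of_pos hβ0 _
  have hη0 : 0 < η := by rw [hη]; exact Real.rpow_pos_of_pos hβ0 _
  have hY0 : 0 < Y := Real.rpow_pos_of_pos hβ0 _
  have hL0 : (0 : ℝ) ≤ L := by linarith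
  have hL2 : (1 : ℝ) ≤ (L : ℝ) ^ 2 := one_le_pow₀ hL1
  have hLL : (L : ℝ) ≤ (L : ℝ) ^ 2 := by nlinarith
  have hX0 : 0 < X := by positivity
  have hYX : Y ≤ X := by rw [hX]; nlinarith
  -- the three elementary products
  have h1 : θ * η / χ = Y := by rw [hθ, hη, hχ]; exact theta_eta_div_chi hβ0
  have h2 : θ * χ ≤ Y := by rw [hθ, hχ]; exact theta_chi_le hβ1
  have h3 : θ * η ≤ Y := by rw [hθ, hη]; exact theta_eta_le hβ1
  have hη1 : η ≤ 1 := by rw [hη]; exact Real.rpow_le_one_of_one_le_of_nonpos hβ1 (by norm_num)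
  -- `D_s ≤ 11 X`, `D_g ≤ 10 X`
  have hDs_eq : Ds = 3 * (L : ℝ) ^ 2 * (θ * η / χ) + 2 * (θ * χ) + 2 * (L : ℝ) ^ 2 * (θ * η) + 4 * L * (θ * η) := by
    rw [hDs]; field_simp; ring
  have hDg_eq : Dg = 2 * (θ * χ) + 8 * (L : ℝ) ^ 2 * (θ * η) := by rw [hDg]; ring
  have hθη0 : 0 ≤ θ * η := by positivity
  have hL2θη : (L : ℝ) ^ 2 * (θ * η) ≤ (L : ℝ) ^ 2 * Y := mul_le_mul_of_nonneg_left h3 (by positivity)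
  have hLθη : (L : ℝ) * (θ * η) ≤ (L : ℝ) ^ 2 * Y := (mul_le_mul_of_nonneg_left h3 hL0).trans (mul_le_mul_of_nonneg_right hLL hY0.le)
  have hDs_le : Ds ≤ 11 * X := by
    rw [hDs_eq, h1, hX]
    linarith
  have hDg_le : Dg ≤ 10 * X := by
    rw [hDg_eq, hX]
    linarith
  have hDs0 : 0 ≤ Ds := by rw [hDs]; positivity
  have hDg0 : 0 ≤ Dg := by rw [hDg]; positivity
  -- squares and linear terms
  have hDs2 : Ds ^ 2 ≤ 121 * X ^ 2 := by
    calc Ds ^ 2 ≤ (11 * X) ^ 2 := pow_le_pow_left₀ hDs0 hDs_le 2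
      _ = 121 * X ^ 2 := by ring
  have hDg2 : Dg ^ 2 ≤ 100 * X ^ 2 := by
    calc Dg ^ 2 ≤ (10 * X) ^ 2 := pow_le_pow_left₀ hDg0 hDg_le 2
      _ = 100 * X ^ 2 := by ring
  have hDsη : 2 * Ds * η ≤ 22 * (X * η) := by
    have h := mul_le_mul_of_nonneg_right hDs_le hη0.le
    linarith
  have hDgη : 2 * Dg * η ≤ 20 * (X * η) := by
    have h := mul_le_mul_of_nonneg_right hDg_le hη0.le
    linarith
  have hβX2 : β * X ^ 2 = (L : ℝ) ^ 4 * β ^ (-(1 / 10 : ℝ)) := by rw [hX, hY]; exact beta_X_sq hβ0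
  have hβXη : β * X * η = (L : ℝ) ^ 2 * β ^ (-(1 / 40 : ℝ)) := by rw [hX, hY, hη]; exact beta_X_eta hβ0
  have hpow : β ^ (-(1 / 10 : ℝ)) ≤ β ^ (-(1 / 40 : ℝ)) := Real.rpow_le_rpow_of_exponent_le hβ1 (by norm_num)
  have hb40 : 0 ≤ β ^ (-(1 / 40 : ℝ)) := Real.rpow_nonneg hβ0.le _
  have hL4 : (L : ℝ) ^ 2 ≤ (L : ℝ) ^ 4 := by nlinarith
  -- the final smallness `1578 L⁸ β^{−1/40} ≤ 1`
  have key : 1578 * β ^ (8 * a - 1 / 40) ≤ 1 := mul_rpow_le_one_of_le (by norm_num) ha320 hβ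
  have hfin : 1578 * (L : ℝ) ^ 8 * β ^ (-(1 / 40 : ℝ)) ≤ 1 :=
    mul_pow_rpow_le_one (M := 1578) (aw := a) (e₀ := -(1 / 40 : ℝ)) (by norm_num) hβ0 hL0 hL 8
      (by rw [show ((8 : ℕ) : ℝ) * a + -(1 / 40 : ℝ) = 8 * a - 1 / 40 by push_cast; ring]; exact key)
  have hA : Ds ^ 2 + 2 * Ds * η ≤ 121 * X ^ 2 + 22 * (X * η) := add_le_add hDs2 hDsη
  have hB : Dg ^ 2 + 2 * Dg * η ≤ 100 * X ^ 2 + 20 * (X * η) := add_le_add hDg2 hDgη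
  have hB0 : 0 ≤ Dg ^ 2 + 2 * Dg * η := by positivity
  have hB1 : 0 ≤ 100 * X ^ 2 + 20 * (X * η) := by positivity
  have hL3 : (0 : ℝ) ≤ 3 * (L : ℝ) ^ 3 := by positivity
  have h36 : 3 * (L : ℝ) ^ 3 ≤ β * (2 * (L : ℝ)) * (3 * (L : ℝ) ^ 3) :=
    le_mul_of_one_le_left hL3 (one_le_mul_of_one_le_of_one_le hβ1 (by linarith))
  have hc1 : β * (2 * (L : ℝ)) * (3 * (L : ℝ) ^ 3 * (Ds ^ 2 + 2 * Ds * η)) ≤ β * (2 * (L : ℝ)) * (3 * (L : ℝ) ^ 3 * (121 * X ^ 2 + 22 * (X * η))) :=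
    mul_le_mul_of_nonneg_left (mul_le_mul_of_nonneg_left hA hL3) (by positivity)
  have hc2 : 3 * (L : ℝ) ^ 3 * (Dg ^ 2 + 2 * Dg * η) ≤ β * (2 * (L : ℝ)) * (3 * (L : ℝ) ^ 3) * (100 * X ^ 2 + 20 * (X * η)) :=
    (mul_le_mul_of_nonneg_left hB hL3).trans (mul_le_mul_of_nonneg_right h36 hB1)
  calc β * (2 * (L : ℝ)) * (3 * (L : ℝ) ^ 3 * (Ds ^ 2 + 2 * Ds * η)) + 3 * (L : ℝ) ^ 3 * (Dg ^ 2 + 2 * Dg * η)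
      ≤ β * (2 * (L : ℝ)) * (3 * (L : ℝ) ^ 3 * (121 * X ^ 2 + 22 * (X * η))) + β * (2 * (L : ℝ)) * (3 * (L : ℝ) ^ 3) * (100 * X ^ 2 + 20 * (X * η)) :=
        add_le_add hc1 hc2
    _ = 6 * (L : ℝ) ^ 4 * (221 * (β * X ^ 2) + 42 * (β * X * η)) := by ring
    _ = 6 * (L : ℝ) ^ 4 * (221 * ((L : ℝ) ^ 4 * β ^ (-(1 / 10 : ℝ))) + 42 * ((L : ℝ) ^ 2 * β ^ (-(1 / 40 : ℝ)))) := by rw [hβX2, hβXη]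
    _ ≤ 6 * (L : ℝ) ^ 4 * (221 * ((L : ℝ) ^ 4 * β ^ (-(1 / 40 : ℝ))) + 42 * ((L : ℝ) ^ 4 * β ^ (-(1 / 40 : ℝ)))) := by
        gcongr
    _ = 1578 * (L : ℝ) ^ 8 * β ^ (-(1 / 40 : ℝ)) := by ring
    _ ≤ 1 := hfin

/-- (floor inputs) `24 L² η ≤ θ` on `L ≤ β^a`, `β ≥ 24^{1/(3/20 − 2a)}`. [folklore] -/
theorem eta_floor_le (ha : 0 < a) (ha' : a ≤ 1 / 400) (hβ1 : 1 ≤ β) (hL : (L : ℝ) ≤ β ^ a)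
    (hβ : (24 : ℝ) ^ (1 / (-(2 * a - 3 / 20))) ≤ β) :
    24 * ((L : ℝ) * (L * β ^ (-(1 / 2 - 1 / 40 : ℝ)))) ≤ β ^ (-(13 / 40 : ℝ)) := by
  have hβ0 : 0 < β := by linarith
  have key : 24 * β ^ (2 * a - 3 / 20) ≤ 1 := mul_rpow_le_one_of_le (by norm_num) (by linarith) hβ
  have h := mul_pow_rpow_le_one (M := 24) (aw := a) (e₀ := -(3 / 20 : ℝ)) (by norm_num) hβ0 (Nat.cast_nonneg L) hL 2
    (by rw [show ((2 : ℕ) : ℝ) * a + -(3 / 20 : ℝ) = 2 * a - 3 / 20 by push_cast; ring]; exact key)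
  have hsplit : β ^ (-(1 / 2 - 1 / 40 : ℝ)) = β ^ (-(3 / 20 : ℝ)) * β ^ (-(13 / 40 : ℝ)) := by
    rw [← Real.rpow_add hβ0]; norm_num
  have hθ0 : 0 ≤ β ^ (-(13 / 40 : ℝ)) := Real.rpow_nonneg hβ0.le _
  calc 24 * ((L : ℝ) * (L * β ^ (-(1 / 2 - 1 / 40 : ℝ)))) = (24 * (L : ℝ) ^ 2 * β ^ (-(3 / 20 : ℝ))) * β ^ (-(13 / 40 : ℝ)) := by
        rw [hsplit]; ring
    _ ≤ 1 * β ^ (-(13 / 40 : ℝ)) := mul_le_mul_of_nonneg_right h hθ0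
    _ = β ^ (-(13 / 40 : ℝ)) := one_mul _

/-- (core below the shift) `3 r ≤ θ`, i.e. `3 β^{−2/5} ≤ β^{−13/40}`, for `β ≥ 3^{40/3}`. [folklore] -/
theorem three_r_le_theta (hβ1 : 1 ≤ β) (hβ : (3 : ℝ) ^ (1 / (-(-(3 / 40 : ℝ)))) ≤ β) :
    3 * β ^ (-(2 / 5 : ℝ)) ≤ β ^ (-(13 / 40 : ℝ)) := by
  have hβ0 : 0 < β := by linarith
  have key : 3 * β ^ (-(3 / 40 : ℝ)) ≤ 1 := mul_rpow_le_one_of_le (by norm_num) (by norm_num) hβ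
  have hsplit : β ^ (-(2 / 5 : ℝ)) = β ^ (-(3 / 40 : ℝ)) * β ^ (-(13 / 40 : ℝ)) := by rw [← Real.rpow_add hβ0]; norm_num
  have hθ0 : 0 ≤ β ^ (-(13 / 40 : ℝ)) := Real.rpow_nonneg hβ0.le _
  calc 3 * β ^ (-(2 / 5 : ℝ)) = (3 * β ^ (-(3 / 40 : ℝ))) * β ^ (-(13 / 40 : ℝ)) := by rw [hsplit]; ring
    _ ≤ 1 * β ^ (-(13 / 40 : ℝ)) := mul_le_mul_of_nonneg_right key hθ0
    _ = β ^ (-(13 / 40 : ℝ)) := one_mul _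

/-- (master bound of the annulus translates) `1000 L⁶ (K · 6r · 6/θ)(βη²) ≤ 1` on `L ≤ β^a`, `a ≤ 1/400`, `β` large. [folklore] -/
theorem master_core (ha : 0 < a) (ha' : a ≤ 1 / 400) (hβ1 : 1 ≤ β) (hL : (L : ℝ) ≤ β ^ a)
    (hβ : (6948000 : ℝ) ^ (1 / (-(7 * a - 1 / 40))) ≤ β) :
    1000 * (L : ℝ) ^ 6 * ((((⌈64 * Real.exp 1 * β ^ a⌉₊ : ℕ) : ℝ) * (6 * β ^ (-(2 / 5 : ℝ)))) * (6 / β ^ (-(13 / 40 : ℝ)))) *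
      (β * (β ^ (-(1 / 2 - 1 / 40 : ℝ))) ^ 2) ≤ 1 := by
  have hβ0 : 0 < β := by linarith
  have hK := ceil_le_bound hβ1 ha.le
  rw [beta_mul_eta_sq hβ0]
  have hrθ : β ^ (-(2 / 5 : ℝ)) * (6 / β ^ (-(13 / 40 : ℝ))) = 6 * β ^ (-(3 / 40 : ℝ)) := by
    rw [mul_div_assoc', mul_comm, mul_div_assoc, ← Real.rpow_sub hβ0]; norm_num
  have hL6 : (L : ℝ) ^ 6 ≤ β ^ ((6 : ℕ) * a) := pow_le_rpow_mul hβ0.le (Nat.cast_nonneg L) hL 6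
  have key : 6948000 * β ^ (7 * a - 1 / 40) ≤ 1 := mul_rpow_le_one_of_le (by norm_num) (by linarith) hβ
  have hsplit : β ^ (7 * a - 1 / 40) = β ^ ((6 : ℕ) * a) * β ^ a * β ^ (-(3 / 40 : ℝ)) * β ^ (2 * (1 / 40 : ℝ)) := by
    rw [← Real.rpow_add hβ0, ← Real.rpow_add hβ0, ← Real.rpow_add hβ0]; congr 1; push_cast; ring
  rw [hsplit] at key
  have h3 : 0 ≤ β ^ (-(3 / 40 : ℝ)) := Real.rpow_nonneg hβ0.le _
  have h2 : 0 ≤ β ^ (2 * (1 / 40 : ℝ)) := Real.rpow_nonneg hβ0.le _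
  have ha0 : 0 ≤ β ^ a := Real.rpow_nonneg hβ0.le _
  calc 1000 * (L : ℝ) ^ 6 * ((((⌈64 * Real.exp 1 * β ^ a⌉₊ : ℕ) : ℝ) * (6 * β ^ (-(2 / 5 : ℝ)))) * (6 / β ^ (-(13 / 40 : ℝ)))) * β ^ (2 * (1 / 40 : ℝ))
      = 6000 * (L : ℝ) ^ 6 * (((⌈64 * Real.exp 1 * β ^ a⌉₊ : ℕ) : ℝ)) * (β ^ (-(2 / 5 : ℝ)) * (6 / β ^ (-(13 / 40 : ℝ)))) * β ^ (2 * (1 / 40 : ℝ)) := by ring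
    _ = 36000 * ((L : ℝ) ^ 6 * ((((⌈64 * Real.exp 1 * β ^ a⌉₊ : ℕ) : ℝ)) * (β ^ (-(3 / 40 : ℝ)) * β ^ (2 * (1 / 40 : ℝ))))) := by rw [hrθ]; ring
    _ ≤ 36000 * (β ^ ((6 : ℕ) * a) * ((193 * β ^ a) * (β ^ (-(3 / 40 : ℝ)) * β ^ (2 * (1 / 40 : ℝ))))) := by gcongr
    _ = 6948000 * (β ^ ((6 : ℕ) * a) * β ^ a * β ^ (-(3 / 40 : ℝ)) * β ^ (2 * (1 / 40 : ℝ))) := by ring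
    _ ≤ 1 := key

/-- (final rate) `(e + 1/2) β^{−a} ≤ β^{−a/2}` for `β ≥ 4^{2/a}`. [folklore] -/
theorem rate_core (ha : 0 < a) (hβ1 : 1 ≤ β) (hβ : (4 : ℝ) ^ (1 / (-(-(a / 2)))) ≤ β) :
    (Real.exp 1 + 1 / 2) * β ^ (-a) ≤ β ^ (-(a / 2)) := by
  have hβ0 : 0 < β := by linarith
  have key : 4 * β ^ (-(a / 2)) ≤ 1 := mul_rpow_le_one_of_le (by norm_num) (by linarith) hβ
  have he : Real.exp 1 + 1 / 2 ≤ 4 := by have := Real.exp_one_lt_d9; linarith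
  have hsplit : β ^ (-a) = β ^ (-(a / 2)) * β ^ (-(a / 2)) := by rw [← Real.rpow_add hβ0]; ring_nf
  have h0 : 0 ≤ β ^ (-(a / 2)) := Real.rpow_nonneg hβ0.le _
  rw [hsplit]
  calc (Real.exp 1 + 1 / 2) * (β ^ (-(a / 2)) * β ^ (-(a / 2))) ≤ 4 * (β ^ (-(a / 2)) * β ^ (-(a / 2))) := by gcongr
    _ = (4 * β ^ (-(a / 2))) * β ^ (-(a / 2)) := by ring
    _ ≤ 1 * β ^ (-(a / 2)) := mul_le_mul_of_nonneg_right key h0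
    _ = β ^ (-(a / 2)) := one_mul _

/-- ★ **The CORE parameter set** (`0 < a ≤ 1/400`, `r = β^{−2/5}`, `θ = β^{−13/40}`, `χ = β^{−1/4}`, `η = β^{−(1/2 − 1/40)}`, `K = ⌈64eβ^a⌉₊`):
all numeric inputs of the periodic-sector core estimate for `β ≥ β₀(a)` and `1 ≤ L ≤ β^a`. [folklore] -/
theorem numericsCore_of_le (ha : 0 < a) (ha' : a ≤ 1 / 400) :
    ∃ β₀ : ℝ, ∀ β : ℝ, β₀ ≤ β → ∀ L : ℕ, 1 ≤ L → (L : ℝ) ≤ β ^ a →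
      200 ≤ β ∧
      β * (2 * (L : ℝ)) * (3 * (L : ℝ) ^ 3 *
        ((β ^ (-(13 / 40 : ℝ)) * (2 * (L * (L * β ^ (-(1 / 2 - 1 / 40 : ℝ)))) / β ^ (-(1 / 4 : ℝ)) + L * (L * β ^ (-(1 / 2 - 1 / 40 : ℝ))) / β ^ (-(1 / 4 : ℝ)) +
            2 * β ^ (-(1 / 4 : ℝ))) + 2 * (L * (L * β ^ (-(1 / 2 - 1 / 40 : ℝ)))) * β ^ (-(13 / 40 : ℝ)) + 2 * ((2 * L) * β ^ (-(1 / 2 - 1 / 40 : ℝ))) * β ^ (-(13 / 40 : ℝ))) ^ 2 +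
          2 * (β ^ (-(13 / 40 : ℝ)) * (2 * (L * (L * β ^ (-(1 / 2 - 1 / 40 : ℝ)))) / β ^ (-(1 / 4 : ℝ)) + L * (L * β ^ (-(1 / 2 - 1 / 40 : ℝ))) / β ^ (-(1 / 4 : ℝ)) +
            2 * β ^ (-(1 / 4 : ℝ))) + 2 * (L * (L * β ^ (-(1 / 2 - 1 / 40 : ℝ)))) * β ^ (-(13 / 40 : ℝ)) + 2 * ((2 * L) * β ^ (-(1 / 2 - 1 / 40 : ℝ))) * β ^ (-(13 / 40 : ℝ))) *
            β ^ (-(1 / 2 - 1 / 40 : ℝ)))) +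
      3 * (L : ℝ) ^ 3 * ((2 * β ^ (-(1 / 4 : ℝ)) * β ^ (-(13 / 40 : ℝ)) + 4 * (L * ((2 * L) * β ^ (-(1 / 2 - 1 / 40 : ℝ)))) * β ^ (-(13 / 40 : ℝ))) ^ 2 +
        2 * (2 * β ^ (-(1 / 4 : ℝ)) * β ^ (-(13 / 40 : ℝ)) + 4 * (L * ((2 * L) * β ^ (-(1 / 2 - 1 / 40 : ℝ)))) * β ^ (-(13 / 40 : ℝ))) * β ^ (-(1 / 2 - 1 / 40 : ℝ))) ≤ 1 ∧
      24 * ((L : ℝ) * (L * β ^ (-(1 / 2 - 1 / 40 : ℝ)))) ≤ β ^ (-(13 / 40 : ℝ)) ∧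
      3 * β ^ (-(2 / 5 : ℝ)) ≤ β ^ (-(13 / 40 : ℝ)) ∧
      1 ≤ ⌈64 * Real.exp 1 * β ^ a⌉₊ ∧
      1 ≤ β * (β ^ (-(1 / 2 - 1 / 40 : ℝ))) ^ 2 ∧
      1000 * (L : ℝ) ^ 6 * ((((⌈64 * Real.exp 1 * β ^ a⌉₊ : ℕ) : ℝ) * (6 * β ^ (-(2 / 5 : ℝ)))) * (6 / β ^ (-(13 / 40 : ℝ)))) *
        (β * (β ^ (-(1 / 2 - 1 / 40 : ℝ))) ^ 2) ≤ 1 ∧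
      4 * (L : ℝ) * Real.exp (-(β * (β ^ (-(1 / 2 - 1 / 40 : ℝ))) ^ 2 / 2)) * (β ^ (315 * L ^ 3)) ^ (2 * L) ≤ β ^ (-a) / 2 ∧
      32 * Real.exp 1 / ((⌈64 * Real.exp 1 * β ^ a⌉₊ : ℕ) : ℝ) ≤ β ^ (-a) / 2 ∧
      (Real.exp 1 + 1 / 2) * β ^ (-a) ≤ β ^ (-(a / 2)) := by
  refine ⟨max (max (max 200 ((1578 : ℝ) ^ (1 / (-(8 * a - 1 / 40))))) (max ((24 : ℝ) ^ (1 / (-(2 * a - 3 / 20)))) ((3 : ℝ) ^ (1 / (-(-(3 / 40 : ℝ)))))))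
    (max (max ((6948000 : ℝ) ^ (1 / (-(7 * a - 1 / 40)))) ((4 : ℝ) ^ (1 / (-(-(a / 2))))))
      (max (((5048 : ℝ) / (1 / 40)) ^ (1 / (1 / 40 : ℝ))) ((12 : ℝ) ^ (1 / (1 / 40 : ℝ))))), fun β hβ L hL1 hL => ?_⟩
  simp only [max_le_iff] at hβ
  obtain ⟨⟨⟨h200, h1578⟩, h24, h3⟩, ⟨h69, h4⟩, hA, hB⟩ := hβ
  have hβ1 : 1 ≤ β := le_trans (by norm_num) h200
  have hβ0 : 0 < β := lt_of_lt_of_le (by norm_num) h200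
  have hL1r : (1 : ℝ) ≤ L := by exact_mod_cast hL1
  refine ⟨h200, gaxis_core_Q rfl rfl rfl rfl rfl ha ha' hβ1 hL1r hL h1578, eta_floor_le ha ha' hβ1 hL h24, three_r_le_theta hβ1 h3,
    Nat.one_le_ceil_iff.2 (by positivity), ?_, master_core ha ha' hβ1 hL h69,
    ineq_bad_gen ha (by linarith) (by norm_num) hβ1 hL hA hB, ineq_count hβ1, rate_core ha hβ1 h4⟩
  rw [beta_mul_eta_sq hβ0]
  exact Real.one_le_rpow hβ1 (by norm_num)

/-- ★ (cost of the seam-axis shift on a ring of `≤ 2L` slices, `β` multiplying the link term too — the form the cost exponent of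
`GAxis.seamDensity_le_exp_mul_gAxisShift` actually has) with `θ = β^{−13/40}`, `χ = β^{−1/4}`, `η = β^{−(1/2−1/40)}`:
`β·2L·3L³(D_s² + 2D_sη) + 3L³(D_g² + 2D_gη) ≤ 1` on `L ≤ β^a` for `β ≥ 1578^{1/(1/40 − 8a)}`, `a < 1/320`. [folklore] -/
theorem gaxis_core_Qβ {θ χ η Ds Dg : ℝ} (hθ : θ = β ^ (-(13 / 40 : ℝ))) (hχ : χ = β ^ (-(1 / 4 : ℝ))) (hη : η = β ^ (-(1 / 2 - 1 / 40 : ℝ)))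
    (hDs : Ds = θ * (2 * (L * (L * η)) / χ + L * (L * η) / χ + 2 * χ) + 2 * (L * (L * η)) * θ + 2 * ((2 * L) * η) * θ)
    (hDg : Dg = 2 * χ * θ + 4 * (L * ((2 * L) * η)) * θ)
    (ha : 0 < a) (ha' : a ≤ 1 / 400) (hβ1 : 1 ≤ β) (hL1 : (1 : ℝ) ≤ L) (hL : (L : ℝ) ≤ β ^ a)
    (hβ : (1578 : ℝ) ^ (1 / (-(8 * a - 1 / 40))) ≤ β) :
    β * ((2 * (L : ℝ)) * (3 * (L : ℝ) ^ 3 * (Ds ^ 2 + 2 * Ds * η)) + 3 * (L : ℝ) ^ 3 * (Dg ^ 2 + 2 * Dg * η)) ≤ 1 := by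
  have hβ0 : 0 < β := by linarith
  have ha320 : 8 * a - 1 / 40 < 0 := by linarith
  set Y : ℝ := β ^ (-(11 / 20 : ℝ)) with hY
  set X : ℝ := (L : ℝ) ^ 2 * Y with hX
  have hθ0 : 0 < θ := by rw [hθ]; exact Real.rpow_pos_of_pos hβ0 _
  have hχ0 : 0 < χ := by rw [hχ]; exact Real.rpow_pos_of_pos hβ0 _
  have hη0 : 0 < η := by rw [hη]; exact Real.rpow_pos_of_pos hβ0 _
  have hY0 : 0 < Y := Real.rpow_pos_of_pos hβ0 _
  have hL0 : (0 : ℝ) ≤ L := by linarith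
  have hL2 : (1 : ℝ) ≤ (L : ℝ) ^ 2 := one_le_pow₀ hL1
  have hLL : (L : ℝ) ≤ (L : ℝ) ^ 2 := by nlinarith
  have hX0 : 0 < X := by positivity
  have hYX : Y ≤ X := by rw [hX]; nlinarith
  -- the three elementary products
  have h1 : θ * η / χ = Y := by rw [hθ, hη, hχ]; exact theta_eta_div_chi hβ0
  have h2 : θ * χ ≤ Y := by rw [hθ, hχ]; exact theta_chi_le hβ1
  have h3 : θ * η ≤ Y := by rw [hθ, hη]; exact theta_eta_le hβ1
  have hη1 : η ≤ 1 := by rw [hη]; exact Real.rpow_le_one_of_one_le_of_nonpos hβ1 (by norm_num)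
  -- `D_s ≤ 11 X`, `D_g ≤ 10 X`
  have hDs_eq : Ds = 3 * (L : ℝ) ^ 2 * (θ * η / χ) + 2 * (θ * χ) + 2 * (L : ℝ) ^ 2 * (θ * η) + 4 * L * (θ * η) := by
    rw [hDs]; field_simp; ring
  have hDg_eq : Dg = 2 * (θ * χ) + 8 * (L : ℝ) ^ 2 * (θ * η) := by rw [hDg]; ring
  have hθη0 : 0 ≤ θ * η := by positivity
  have hL2θη : (L : ℝ) ^ 2 * (θ * η) ≤ (L : ℝ) ^ 2 * Y := mul_le_mul_of_nonneg_left h3 (by positivity)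
  have hLθη : (L : ℝ) * (θ * η) ≤ (L : ℝ) ^ 2 * Y := (mul_le_mul_of_nonneg_left h3 hL0).trans (mul_le_mul_of_nonneg_right hLL hY0.le)
  have hDs_le : Ds ≤ 11 * X := by
    rw [hDs_eq, h1, hX]
    linarith
  have hDg_le : Dg ≤ 10 * X := by
    rw [hDg_eq, hX]
    linarith
  have hDs0 : 0 ≤ Ds := by rw [hDs]; positivity
  have hDg0 : 0 ≤ Dg := by rw [hDg]; positivity
  -- squares and linear terms
  have hDs2 : Ds ^ 2 ≤ 121 * X ^ 2 := by
    calc Ds ^ 2 ≤ (11 * X) ^ 2 := pow_le_pow_left₀ hDs0 hDs_le 2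
      _ = 121 * X ^ 2 := by ring
  have hDg2 : Dg ^ 2 ≤ 100 * X ^ 2 := by
    calc Dg ^ 2 ≤ (10 * X) ^ 2 := pow_le_pow_left₀ hDg0 hDg_le 2
      _ = 100 * X ^ 2 := by ring
  have hDsη : 2 * Ds * η ≤ 22 * (X * η) := by
    have h := mul_le_mul_of_nonneg_right hDs_le hη0.le
    linarith
  have hDgη : 2 * Dg * η ≤ 20 * (X * η) := by
    have h := mul_le_mul_of_nonneg_right hDg_le hη0.le
    linarith
  have hβX2 : β * X ^ 2 = (L : ℝ) ^ 4 * β ^ (-(1 / 10 : ℝ)) := by rw [hX, hY]; exact beta_X_sq hβ0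
  have hβXη : β * X * η = (L : ℝ) ^ 2 * β ^ (-(1 / 40 : ℝ)) := by rw [hX, hY, hη]; exact beta_X_eta hβ0
  have hpow : β ^ (-(1 / 10 : ℝ)) ≤ β ^ (-(1 / 40 : ℝ)) := Real.rpow_le_rpow_of_exponent_le hβ1 (by norm_num)
  have hb40 : 0 ≤ β ^ (-(1 / 40 : ℝ)) := Real.rpow_nonneg hβ0.le _
  have hL4 : (L : ℝ) ^ 2 ≤ (L : ℝ) ^ 4 := by nlinarith
  -- the final smallness `1578 L⁸ β^{−1/40} ≤ 1`
  have key : 1578 * β ^ (8 * a - 1 / 40) ≤ 1 := mul_rpow_le_one_of_le (by norm_num) ha320 hβ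
  have hfin : 1578 * (L : ℝ) ^ 8 * β ^ (-(1 / 40 : ℝ)) ≤ 1 :=
    mul_pow_rpow_le_one (M := 1578) (aw := a) (e₀ := -(1 / 40 : ℝ)) (by norm_num) hβ0 hL0 hL 8
      (by rw [show ((8 : ℕ) : ℝ) * a + -(1 / 40 : ℝ) = 8 * a - 1 / 40 by push_cast; ring]; exact key)
  have hA : Ds ^ 2 + 2 * Ds * η ≤ 121 * X ^ 2 + 22 * (X * η) := add_le_add hDs2 hDsη
  have hB : Dg ^ 2 + 2 * Dg * η ≤ 100 * X ^ 2 + 20 * (X * η) := add_le_add hDg2 hDgη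
  have hB0 : 0 ≤ Dg ^ 2 + 2 * Dg * η := by positivity
  have hB1 : 0 ≤ 100 * X ^ 2 + 20 * (X * η) := by positivity
  have hL3 : (0 : ℝ) ≤ 3 * (L : ℝ) ^ 3 := by positivity
  have h2L : (1 : ℝ) ≤ 2 * (L : ℝ) := by linarith
  have hc1 : (2 * (L : ℝ)) * (3 * (L : ℝ) ^ 3 * (Ds ^ 2 + 2 * Ds * η)) ≤ (2 * (L : ℝ)) * (3 * (L : ℝ) ^ 3 * (121 * X ^ 2 + 22 * (X * η))) :=
    mul_le_mul_of_nonneg_left (mul_le_mul_of_nonneg_left hA hL3) (by positivity)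
  have hc2 : 3 * (L : ℝ) ^ 3 * (Dg ^ 2 + 2 * Dg * η) ≤ (2 * (L : ℝ)) * (3 * (L : ℝ) ^ 3) * (100 * X ^ 2 + 20 * (X * η)) :=
    (mul_le_mul_of_nonneg_left hB hL3).trans (le_mul_of_one_le_left (by positivity) h2L |>.trans_eq (by ring))
  calc β * ((2 * (L : ℝ)) * (3 * (L : ℝ) ^ 3 * (Ds ^ 2 + 2 * Ds * η)) + 3 * (L : ℝ) ^ 3 * (Dg ^ 2 + 2 * Dg * η))
      ≤ β * ((2 * (L : ℝ)) * (3 * (L : ℝ) ^ 3 * (121 * X ^ 2 + 22 * (X * η))) + (2 * (L : ℝ)) * (3 * (L : ℝ) ^ 3) * (100 * X ^ 2 + 20 * (X * η))) :=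
        mul_le_mul_of_nonneg_left (add_le_add hc1 hc2) hβ0.le
    _ = 6 * (L : ℝ) ^ 4 * (221 * (β * X ^ 2) + 42 * (β * X * η)) := by ring
    _ = 6 * (L : ℝ) ^ 4 * (221 * ((L : ℝ) ^ 4 * β ^ (-(1 / 10 : ℝ))) + 42 * ((L : ℝ) ^ 2 * β ^ (-(1 / 40 : ℝ)))) := by rw [hβX2, hβXη]
    _ ≤ 6 * (L : ℝ) ^ 4 * (221 * ((L : ℝ) ^ 4 * β ^ (-(1 / 40 : ℝ))) + 42 * ((L : ℝ) ^ 4 * β ^ (-(1 / 40 : ℝ)))) := by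
        gcongr
    _ = 1578 * (L : ℝ) ^ 8 * β ^ (-(1 / 40 : ℝ)) := by ring
    _ ≤ 1 := hfin

/-- ★ **The cost input with `β` inside** for `β ≥ β₀(a)`, `1 ≤ L ≤ β^a` (the form consumed by the periodic-sector core estimate). [folklore] -/
theorem numericsCoreQ_of_le (ha : 0 < a) (ha' : a ≤ 1 / 400) :
    ∃ β₀ : ℝ, ∀ β : ℝ, β₀ ≤ β → ∀ L : ℕ, 1 ≤ L → (L : ℝ) ≤ β ^ a →
      β * ((2 * (L : ℝ)) * (3 * (L : ℝ) ^ 3 *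
        ((β ^ (-(13 / 40 : ℝ)) * (2 * (L * (L * β ^ (-(1 / 2 - 1 / 40 : ℝ)))) / β ^ (-(1 / 4 : ℝ)) + L * (L * β ^ (-(1 / 2 - 1 / 40 : ℝ))) / β ^ (-(1 / 4 : ℝ)) +
            2 * β ^ (-(1 / 4 : ℝ))) + 2 * (L * (L * β ^ (-(1 / 2 - 1 / 40 : ℝ)))) * β ^ (-(13 / 40 : ℝ)) + 2 * ((2 * L) * β ^ (-(1 / 2 - 1 / 40 : ℝ))) * β ^ (-(13 / 40 : ℝ))) ^ 2 +
          2 * (β ^ (-(13 / 40 : ℝ)) * (2 * (L * (L * β ^ (-(1 / 2 - 1 / 40 : ℝ)))) / β ^ (-(1 / 4 : ℝ)) + L * (L * β ^ (-(1 / 2 - 1 / 40 : ℝ))) / β ^ (-(1 / 4 : ℝ)) +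
            2 * β ^ (-(1 / 4 : ℝ))) + 2 * (L * (L * β ^ (-(1 / 2 - 1 / 40 : ℝ)))) * β ^ (-(13 / 40 : ℝ)) + 2 * ((2 * L) * β ^ (-(1 / 2 - 1 / 40 : ℝ))) * β ^ (-(13 / 40 : ℝ))) *
            β ^ (-(1 / 2 - 1 / 40 : ℝ)))) +
      3 * (L : ℝ) ^ 3 * ((2 * β ^ (-(1 / 4 : ℝ)) * β ^ (-(13 / 40 : ℝ)) + 4 * (L * ((2 * L) * β ^ (-(1 / 2 - 1 / 40 : ℝ)))) * β ^ (-(13 / 40 : ℝ))) ^ 2 +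
        2 * (2 * β ^ (-(1 / 4 : ℝ)) * β ^ (-(13 / 40 : ℝ)) + 4 * (L * ((2 * L) * β ^ (-(1 / 2 - 1 / 40 : ℝ)))) * β ^ (-(13 / 40 : ℝ))) * β ^ (-(1 / 2 - 1 / 40 : ℝ)))) ≤ 1 := by
  refine ⟨max 1 ((1578 : ℝ) ^ (1 / (-(8 * a - 1 / 40)))), fun β hβ L hL1 hL => ?_⟩
  have hβ1 : 1 ≤ β := le_trans (le_max_left _ _) hβ
  have h1578 : (1578 : ℝ) ^ (1 / (-(8 * a - 1 / 40))) ≤ β := le_trans (le_max_right _ _) hβ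
  have hL1r : (1 : ℝ) ≤ L := by exact_mod_cast hL1
  exact gaxis_core_Qβ rfl rfl rfl rfl rfl ha ha' hβ1 hL1r hL h1578

end Core

end Summit.QuantumFields.YangMills.Theorems.FemtoTransferGap.OwnAxis

end
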